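import Literature.AnabelianGeometry.SemiGraphs.TemperedMaximalCompactOfStabilizerLevel
import Literature.AnabelianGeometry.SemiGraphs.TemperedAnchoredCompactOfTopCyclic
import Literature.AnabelianGeometry.SemiGraphs.MetabelianLeafStarAdaptedLevel
import Literature.AnabelianGeometry.SemiGraphs.MetabelianLeafStarElevated
import HarnessLib

/-!
# At the rayless star `𝒢⋆(p)` EVERY verticial subgroup is a MAXIMAL compact subgroup
# ([SemiAnbd] Thm 3.7 (iv), «⇐» half, p. 41) — by name, and by an explicit «no fixed edge» at ONE level

Mochizuki, *Semi-graphs of anabelioids*, Publ. RIMS **42** (2006), §3, Theorem 3.7 (iv), manuscript p. 41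
("the maximal compact subgroups of `π₁^temp(𝒢)` are precisely the verticial subgroups"; print's `𝔾` is finite)
[cite: MochizukiSemiAnbd2006, Thm 3.7(iv) p.41].

PROOF-ONLY file (abc-iut cell, layer L3, row «T37iv-VERT⇒MAXCPT@RAYLESS-STAR», L3-lead γ69 (2)/γ86 (1); seat
abc-iut-L3-t6 gen 9; no definition, no named fact).  The carrier is abc-iut-L3-t8's rayless star
`metabelianLeafStar p` (`𝒢⋆(p)`: centre `F̂₂⁽ᵖ⁾`, leaves `ℤ_p ⋊ ⟨1+p^{n+1}⟩‾`, all edge groups `ℤ_p`, centre of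
INFINITE valence — the level trees are NOT locally finite, so abc-iut-w6-d063's
`isMaximalCompactSubgroup_of_mem_verticialSubgroups_of_locallyFinite` is silent), where the «⇒» half of (iv) /
the existence sentence of (iii) FAIL in the cell's ∀-countable typing (`MetabelianLeafStarEscape.lean`).

* `metabelianLeafStar_isMaximalCompactSubgroup_of_mem_verticialSubgroups` — **every verticial subgroup of
  `π₁^temp(𝒢⋆(p))` is maximal compact, at EVERY chart, hypothesis-free**: the one-line instance of
  abc-iut-w6-d064's class theorem `isMaximalCompactSubgroup_of_mem_verticialSubgroups_of_topCyclic`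
  (`TemperedAnchoredCompactOfTopCyclic.lean`; edge groups topologically cyclic, any `𝔾`).
* INDEPENDENT CONTENT — the explicit «no fixed edge» at the star, modulo `p`, at ONE level of the canonical
  tower: `FreeProPRankTwo.b_inv_mul_conj_θα_not_mem_centreLevel_one` (the generator `b` of `F̂₂⁽ᵖ⁾` lies in no
  `(f A_m f⁻¹)·K`, `K` the centre level of bound `1`: abelianise mod `p`) and
  `Iw.translLeaf_inv_mul_conj_lowHom_not_mem_leafLevel_one` (the translation `(1,0)` of a leaf lies in no
  `(f B_m f⁻¹)·K`, `K` the leaf level of modulus `1`: the translation coordinate of a conjugate of a torus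
  element vanishes mod `p`, `IwMod.conj_coords`), whence `metabelianLeafStar_noFixedEdge_witness` and a SECOND
  proof at the chart of Prop 3.6 through abc-iut-L3-t6's one-level criterion
  `isMaximalCompactSubgroup_of_forall_pointSeq_stabilizer_level` (`TemperedMaximalCompactOfStabilizerLevel.lean`,
  Kőnig-free `TemperedMaximalCompactOfNoFixedEdge.lean`) fed by abc-iut-L3-t8's adapted level
  `exists_level_stabilizer_mem_leafStarVertexLevel` — no commutativity of edge groups is used on this route.
Honest framing: a theorem at OUR carrier `𝒢⋆(p)`, not a claim about print's finite `𝔾` (kernel: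
`maximalCompactIffVerticialAt_of_finiteGraph`); nothing here bears on [IUTchIII] Cor. 3.12; no side taken.
-/

noncomputable section

open Topology Multiplicative

namespace Literature.AnabelianGeometry.SemiGraphs

open IwahoriWitness

/-! ### The «⇐» half of Thm 3.7 (iv) at `𝒢⋆(p)`, every chart (by name) -/

namespace ProfiniteSemiGraph

variable (p : ℕ) [hp : Fact p.Prime]

/-- **At the rayless star `𝒢⋆(p)` every verticial subgroup of `π₁^temp` is a MAXIMAL compact subgroup**, at
every chart and with no hypothesis (the edge groups `ℤ_p` are topologically cyclic; abc-iut-w6-d064's class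
theorem; Thm 3.7 hypotheses by abc-iut-L3-t8's `metabelianLeafStar_thm37Hypotheses'`).
[cite: MochizukiSemiAnbd2006, Thm 3.7(iv) p.41] -/
theorem metabelianLeafStar_isMaximalCompactSubgroup_of_mem_verticialSubgroups
    (c : TemperedPiChart (metabelianLeafStar p)) {v : (metabelianLeafStar p).graph.Vertex} {V : Subgroup c.G}
    (hV : V ∈ verticialSubgroups c v) : IsMaximalCompactSubgroup V :=
  isMaximalCompactSubgroup_of_mem_verticialSubgroups_of_topCyclic _ (metabelianLeafStar_thm37Hypotheses' p)
    (fun _ => ⟨ofAdd (1 : ℤ_[p]), FreeProPRankTwo.topologicalClosure_zpowers_ofAdd_one p⟩) c hV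

/-- The «⇐» half of `MaximalCompactIffVerticialAt (𝒢⋆(p))`, first clause, as a closed sentence.
[cite: MochizukiSemiAnbd2006, Thm 3.7(iv) p.41] -/
theorem metabelianLeafStar_isMaximalCompactSubgroup_of_exists_mem_verticialSubgroups :
    ∀ (c : TemperedPiChart (metabelianLeafStar p)) (K : Subgroup c.G),
      (∃ v, K ∈ verticialSubgroups c v) → IsMaximalCompactSubgroup K :=
  fun c _ ⟨_, hK⟩ => metabelianLeafStar_isMaximalCompactSubgroup_of_mem_verticialSubgroups p c hK

end ProfiniteSemiGraph

/-! ### The explicit witnesses: no fixed edge at ONE level, modulo `p` -/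

namespace FreeProPRankTwo

variable (p : ℕ) [hp : Fact p.Prime]

/-- The abelianisation kills conjugation. [cite: RibesZalesskii2010, §3.3] -/
theorem ab_conj (f y : Grp p) : ab p (f * y * f⁻¹) = ab p y := by
  rw [map_mul, map_mul, map_inv, mul_comm (ab p f) _, mul_inv_cancel_right]

/-- `ab(θα_m(k)) = (k, p^m k)`: the abelianised centre branch group `A_m` is the line of slope `p^m`.
[cite: RibesZalesskii2010, §3.3] -/
theorem ab_θα (m : ℕ) (k : Multiplicative ℤ_[p]) :
    ab p (θα p m k) = ofAdd (k.toAdd, (p : ℤ_[p]) ^ m * k.toAdd) := by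
  rw [θα_apply, ab_θ, ab_α, toAdd_ofAdd]
  simp

/-- **Centre witness**: the generator `b` lies in no set `(f · A_m · f⁻¹) · K_1`, `K_1 = ab⁻¹(pℤ_p × pℤ_p)`:
abelianising, `(0,1) ≡ (k, p^m k) (mod p)` forces `p ∣ 1`. [cite: MochizukiSemiAnbd2006, Thm 3.7(iv) p.41] -/
theorem b_inv_mul_conj_θα_not_mem_abLevel_one (m : ℕ) (f : Grp p) (k : Multiplicative ℤ_[p]) :
    (b p)⁻¹ * (f * θα p m k * f⁻¹) ∉ abLevel p 1 := by
  intro hmem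
  rw [mem_abLevel_iff] at hmem
  obtain ⟨h1, h2⟩ := hmem
  rw [map_mul, map_inv, ab_conj, ab_b, ab_θα] at h1 h2
  simp only [pow_one, toAdd_mul, toAdd_inv, toAdd_ofAdd, Prod.neg_mk, Prod.mk_add_mk, neg_zero,
    zero_add] at h1 h2
  have h3 : (p : ℤ_[p]) ∣ (1 : ℤ_[p]) := by
    have h4 : (p : ℤ_[p]) ∣ (p : ℤ_[p]) ^ m * k.toAdd := h1.mul_left _
    have h5 := dvd_sub h4 h2
    have e : (p : ℤ_[p]) ^ m * k.toAdd - (-1 + (p : ℤ_[p]) ^ m * k.toAdd) = 1 := by ring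
    rwa [e] at h5
  have hu : IsUnit (p : ℤ_[p]) := isUnit_of_dvd_one h3
  rw [PadicInt.isUnit_iff, PadicInt.norm_p] at hu
  have hp1 : (1 : ℝ) < p := by exact_mod_cast hp.out.one_lt
  exact absurd hu (ne_of_lt (inv_lt_one_of_one_lt₀ hp1))

/-- … hence in no `(f · A_m · f⁻¹) · (centre level of bound 1)`. [cite: MochizukiSemiAnbd2006, Thm 3.7(iv) p.41] -/
theorem b_inv_mul_conj_θα_not_mem_centreLevel_one (m : ℕ) (f : Grp p) (k : Multiplicative ℤ_[p]) :
    (b p)⁻¹ * (f * θα p m k * f⁻¹) ∉ centreLevel p 1 := fun h =>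
  b_inv_mul_conj_θα_not_mem_abLevel_one p m f k h.2

end FreeProPRankTwo

namespace Iw

variable {p : ℕ} [hp : Fact p.Prime]

/-- The leaf gluing has zero translation coordinate. [cite: MochizukiSemiAnbd2006, §2 p.23] -/
theorem lowHom_a (m : ℕ) (k : Multiplicative ℤ_[p]) : ((lowHom (p := p) m k : Leaf (p := p) m) : Iw p).a = 0 :=
  (mem_range_lowHom_iff _).1 ⟨k, rfl⟩

/-- **Leaf witness**: the translation `(1,0)` lies in no set `(f · B_m · f⁻¹) · (leaf level of modulus 1)`:
modulo `p` the translation coordinate of a conjugate of a torus element vanishes (`IwMod.conj_coords`), while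
that of the translation is `1`. [cite: MochizukiSemiAnbd2006, Thm 3.7(iv) p.41] -/
theorem translLeaf_inv_mul_conj_lowHom_not_mem_leafLevel_one (W : Subgroup (Multiplicative ℤ_[p])) (m : ℕ)
    (f : Leaf (p := p) m) (k : Multiplicative ℤ_[p]) :
    (translLeaf m)⁻¹ * (f * lowHom m k * f⁻¹) ∉ leafLevel W m 1 := by
  intro hmem
  rw [mem_leafLevel_iff] at hmem
  obtain ⟨h1, -⟩ := hmem
  have h2 : toMod 1 (((translLeaf m)⁻¹ * (f * lowHom m k * f⁻¹) : Leaf (p := p) m) : Iw p) =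
      (toMod 1 (transl : Iw p))⁻¹ * (toMod 1 (f : Iw p) * toMod 1 ((lowHom m k : Leaf (p := p) m) : Iw p) *
        (toMod 1 (f : Iw p))⁻¹) := by
    simp only [Subgroup.coe_mul, Subgroup.coe_inv, map_mul, map_inv]
    rfl
  rw [h2, inv_mul_eq_one] at h1
  have ha := congrArg IwMod.a h1
  have hs : (toMod 1 ((lowHom m k : Leaf (p := p) m) : Iw p)).a = 0 := by
    rw [toMod_a, lowHom_a, map_zero]
  have hp0 : (p : ZMod (p ^ 1)) = 0 := by
    rw [ZMod.natCast_eq_zero_iff, pow_one]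
  rw [(IwMod.conj_coords _ _).2, hs, mul_zero, add_zero, hp0, zero_mul, zero_mul, neg_zero, toMod_a] at ha
  change PadicInt.toZModPow 1 (1 : ℤ_[p]) = 0 at ha
  rw [map_one] at ha
  haveI : Fact (1 < p ^ 1) := ⟨by rw [pow_one]; exact hp.out.one_lt⟩
  exact one_ne_zero ha

end Iw

/-! ### The second proof: «no fixed edge» at one adapted level of the canonical tower -/

namespace ProfiniteSemiGraph

variable (p : ℕ) [hp : Fact p.Prime]

/-- **The witnesses, packaged**: at every vertex `v` of `𝒢⋆(p)`, for every branch `b` at `v` and every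
`f ∈ Π_v`, some `h ∈ Π_v` avoids `(f Π_b f⁻¹) · (quasi-coherence level of bound 1 at v)`.
[cite: MochizukiSemiAnbd2006, Thm 3.7(iv) p.41] -/
theorem metabelianLeafStar_noFixedEdge_witness (v : (metabelianLeafStar p).graph.Vertex)
    (b : (metabelianLeafStar p).graph.Branch) (hb : (metabelianLeafStar p).graph.abuts b = some v)
    (f : (metabelianLeafStar p).Gv v) :
    ∃ h : (metabelianLeafStar p).Gv v, ∀ k : (metabelianLeafStar p).Ge ((metabelianLeafStar p).graph.edgeOf b),
      h⁻¹ * (f * (metabelianLeafStar p).brHom b v hb k * f⁻¹) ∉ leafStarVertexLevel p 1 v := by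
  obtain ⟨m, c⟩ := b
  cases v with
  | none =>
    cases c with
    | false => exact absurd hb (by simp)
    | true => exact ⟨FreeProPRankTwo.b p, fun k =>
        FreeProPRankTwo.b_inv_mul_conj_θα_not_mem_centreLevel_one p m f k⟩
  | some m' =>
    cases c with
    | true => exact absurd hb (by simp)
    | false =>
      obtain rfl : m = m' := by simpa [SemiGraph.leafStar_abuts_eq_some_some_iff] using hb
      exact ⟨Iw.translLeaf m, fun k => Iw.translLeaf_inv_mul_conj_lowHom_not_mem_leafLevel_one _ m f k⟩

/-- **Second proof at the chart of Prop 3.6, by «no fixed edge at one level»** (no commutativity of edge groups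
used): abc-iut-L3-t8's adapted level puts the point stabilisers of the finite level inside the quasi-coherence
levels of bound `1`, which the witnesses above escape; abc-iut-L3-t6's criterion concludes.
[cite: MochizukiSemiAnbd2006, Thm 3.7(iv) p.41] -/
theorem metabelianLeafStar_isMaximalCompactSubgroup_temperedPiChart_of_noFixedEdge
    (h36 : (metabelianLeafStar p).Prop36Hypotheses) {v : (metabelianLeafStar p).graph.Vertex}
    {V : Subgroup ((metabelianLeafStar p).temperedPiChart h36).G}
    (hV : V ∈ verticialSubgroups ((metabelianLeafStar p).temperedPiChart h36) v) :
    IsMaximalCompactSubgroup V := by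
  obtain ⟨i, hi⟩ := exists_level_stabilizer_mem_leafStarVertexLevel p h36 1
  exact isMaximalCompactSubgroup_of_forall_pointSeq_stabilizer_level (metabelianLeafStar_thm37Hypotheses' p) hV
    fun P _ => ⟨i, leafStarVertexLevel p 1 v, fun u hu => (hi i le_rfl).1 v _ u hu,
      fun b hb f => metabelianLeafStar_noFixedEdge_witness p v b hb f⟩

end ProfiniteSemiGraph

end Literature.AnabelianGeometry.SemiGraphs

end
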